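/-
Copyright (c) 2026 the pub-hodgecm-mathlib formalisation cell (harness21).  Prover seat hodgecm-mathlib-LH10-p01 (g12): road M6 → F3 → F5 (LEAD F0P3a-plan T15-32 «GO-LOW»),
brick (B2e) «THE 2-FREE CLASS VALUES FROM EISENSTEIN DATA, X-FREE» — the (ii)-shape corollaries of ★ (B2b-II) p853378 ∕ ★ (B2c-II) p853410 over ★ (B2d) p853393 — for the
(B3) F5 head of LH7-p04 (g12); 2026-09-03.
-/
import Literature.NumberTheory.Rogawski1990.DepthZeroKappaTransferTypeTwoRowZeroAtFrame    -- ★ (B2c-II) p853410 (brings ★ (B2b-II) p853378, ★ (B2b-I), ★ (O-5), ★ F5-(0), the frame kit `localNonsplitCongr`)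
import Literature.NumberTheory.Rogawski1990.TypeTwoPairPackageInertPlace                  -- ★ (B2d) p853393 (LH4-p01): `exists_pairPackage_inertPlace` (the CM wrapper, row split inside)
import Literature.NumberTheory.Rogawski1990.TypeTwoCayleyShiftCM                           -- ★ `transpose_map_fst_evalRingHom_mul`, `map_finGammaTwo_mul_finGammaTwo` (unitarity of the `w`-avatars), ★ `placeForm_antidiagTwo_eq`
import HarnessLib

/-!
# The 2-free class values of a depth-zero type-(2) match from Eisenstein data alone (★ (B2b-II) ∕ ★ (B2c-II) with the frame and ★ F5-(0)'s block X discharged by ★ (B2d))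

Topic `NumberTheory/Rogawski1990`; namespace `Literature.NumberTheory.Rogawski1990`.  THEOREMS ONLY (no definition, no instance, no notation, no named fact, no `sorry`);
kernel lane `--supports stmt-HodgeConjecture-24833`.  Cell `pub/hodgecm-mathlib` (D-0151), crux H413 = `stmt-HodgeConjecture-24833`; road M6 → F3 → F5 «2-free type-(2) G-side head»
(LEAD F0P3a-plan T15-32 «GO-LOW»), brick **(B2e) «CLASS VALUES FROM EISENSTEIN DATA, X-FREE»** = the plumbing-(ii) shape asked by the (B3) pen LH7-p04 (g12) (02:57:07Z «I vote
(ii) … then (B3) is literally four `exact`s»): the four placeholders `hTp hTm h0p h0m` of the (B3) F5 head `finsum_finExplicitDelta_mul_classOrbitalIntegral_depthZero_eq_of_eisensteinData`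
over the head's OWN letters — no frame `T`, no block frame `(c_fr, φ_b)`, no θ-package, no gate.  HONEST LABEL: HC_CM is proved only modulo the 7 printed citations (2 remaining
named inputs: hLiu418 = stmt-HodgeConjecture-24832, h413 = stmt-HodgeConjecture-24833) until rung 0 closes; count-neutral assembly of ★ bricks (pays no organ; zero label movement
until F5 ★ and a desk-priced rider).

THE MATHEMATICS.  Everything is ★; this file only threads it.  At an inert place `w ∣ v` unramified in `L` (any residue characteristic) the form `H′_w` has an integral hyperbolic
frame `T ∈ GL₃(𝒪_w)`, `H′_w = ᵗ(σ_wT)·J₀·T` (★ `exists_glInt_placeForm_eq_formCongr_antidiagonal_of_isUnramifiedIn`, [Jacobowitz1962, §7]); a match `δ` of `γ_H = (g, u)` has a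
block frame `c` (`c·ι_v(γ_H)·c⁻¹ = δ`), and the block-frame algebra map `φ_b` at `c_fr = T·c_w` (★ (O-5) `exists_algHom_blockFrame`) has `φ_b(g_w, u_w) = T δ_w T⁻¹` (★ (O-5)-place),
which is `J₀`-unitary because `δ_w` is `H′_w`-unitary (★ `localNonsplitCongr`: `g ↦ T g_w T⁻¹` lands in `U(σ_w, J₀)`); `u_w σ_w(u_w) = 1` and `ᵗ(σ_w g_w)·antidiag(1,1)·g_w = antidiag(1,1)`
are the memberships of `γ_H` in `U(Φ₂) × U(Φ₁)` read at `w` (★ `map_finGammaTwo_mul_finGammaTwo`, ★ `transpose_map_fst_evalRingHom_mul`); `g_w, u_w` are integral by the depth-zero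
letters `hg1 hu1`.  These are exactly the inputs of ★ (B2d) `exists_pairPackage_inertPlace` at `J := J₀`, which returns ★ F5-(0)'s block X (eigen-field model `M ∕ L`, θ-package,
endoscopic frame, root letters, ⋆-polynomial, gate) for THIS `(c_fr, φ_b)`; feeding X to ★ (B2b-II) ∕ ★ (B2c-II) gives the four class values:
`n₀+n₁+n₂ = Φ_n(N)` ∕ `Φ′_n(N)` and `n₀ = Φ_{n−2}(N−1)` ∕ `Φ′_{n−2}(N−1)` (`q = #𝓀(L⁺_v)`) according as `κ_v(γ_H, δ) = ±1`.
[cite: Rogawski1990, §4.9 Lemma 4.9.3 p. 56, Prop. 4.9.1 (b) p. 55; §4.8 Case (a) p. 53] [cite: Kottwitz1986BaseChangeUnits, §1 pp. 240–241] [cite: Flicker1998UnitaryFL, Prop. 11 p. 87, Props. 16–17 pp. 96–97, Theorem 18 p. 97]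

* `class_values_of_eisensteinData` (private key: the four implications at once);
* **`sum_ncard_rankStrata_eq_phiTHn_of_eisensteinData_of_finKappaAt_eq_one`**, **`sum_ncard_rankStrata_eq_phiTHprimen_of_eisensteinData_of_finKappaAt_eq_neg_one`** (totals),
  **`ncard_rankStrata_zero_eq_phiTHn_of_eisensteinData_of_finKappaAt_eq_one`**, **`ncard_rankStrata_zero_eq_phiTHprimen_of_eisensteinData_of_finKappaAt_eq_neg_one`** (row 0).

## References
* [Rogawski1990] J. D. Rogawski, *Automorphic Representations of Unitary Groups in Three Variables*, Ann. of Math. Stud. 123 (1990): §4.9 Lemma 4.9.3 p. 56, Prop. 4.9.1 (b) p. 55; §4.8 p. 53.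
* [Kottwitz1986BaseChangeUnits] R. E. Kottwitz, *Base change for unit elements of Hecke algebras*, Compositio Math. 60 (1986): §1 pp. 240–241.
* [Flicker1998UnitaryFL] Y. Z. Flicker, *Elementary proof of the fundamental lemma for a unitary group*, Canad. J. Math. 50 (1998): Prop. 11 p. 87, Props. 16–17, Theorem 18 p. 97.
* [Jacobowitz1962] R. Jacobowitz, *Hermitian forms over local fields*, Amer. J. Math. 84 (1962): §7.
-/

set_option autoImplicit false

noncomputable section

open NumberField IsDedekindDomain Matrix Polynomial ValuativeRel
open scoped MatrixGroups WithZero ValuativeRel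

namespace Literature.NumberTheory.Rogawski1990

open Literature.NumberTheory.Automorphic Literature.NumberTheory.Automorphic.UnitaryGroup Literature.NumberTheory.Automorphic.IntegralReduction
open Literature.NumberTheory.Automorphic.UnitaryLatticeTree Literature.NumberTheory.Automorphic.HermitianLattice Literature.NumberTheory.GaloisRepresentations Literature.NumberTheory.NumberFields
open Literature.NumberTheory.Rogawski1990.Flicker1998 (phiTHn phiTHprimen)

variable (L : Type) [Field L] [NumberField L] [IsCMField L] (H' : Matrix (Fin 3) (Fin 3) L)
  {v : HeightOneSpectrum (𝓞 ↥(maximalRealSubfield L))}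

section Eisenstein

variable {L H'}
  (hH' : (H'.map (IsCMField.complexConj L))ᵀ = H') (w : PlacesOver L v)
  (hw : IsCMField.complexConj L • w.1 = w.1) (hv : Algebra.IsUnramifiedIn (𝓞 L) v.asIdeal)
  (hH'w : IsUnit (placeForm H' w.1)) (hH'i : hH'w.unit ∈ glInt 3 (w.1.adicCompletion L)) (hH'u : IsUnit H')
  {γH : (cmDatum L 2 (Matrix.of fun i j : Fin 2 => if i.val + j.val + 1 = 2 then (1 : L) else 0)).Local v ×
    (cmDatum L 1 (Matrix.of fun i j : Fin 1 => if i.val + j.val + 1 = 1 then (1 : L) else 0)).Local v}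
  (hreg : IsLocalGRegular L v γH)
  (hirr : ¬ ∃ x : w.1.adicCompletion L, (((γH.1.val : GL (Fin 2) (LocalRing L v)).val.map
      (Pi.evalRingHom (fun w' : PlacesOver L v => w'.1.adicCompletion L) w)).charpoly).IsRoot x)
  (δ : (cmDatum L 3 H').Local v) (h : IsLocalNormPair L H' v γH δ)
  (ht : ∀ m : ℕ, ValuativeRel.valuation (w.1.adicCompletion L)
    (((((δ.val : GL (Fin 3) (LocalRing L v)).val.map (Pi.evalRingHom (fun w' : UnitaryGroup.PlacesOver L v => w'.1.adicCompletion L) w))).charpoly -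
      (Polynomial.X - 1) ^ 3).coeff m) < 1)

set_option synthInstance.maxHeartbeats 200000 in
set_option maxHeartbeats 1600000 in
-- the strata sets and ★ (B2b-II) ∕ (B2c-II)'s ≈ 60-binder instantiations are large terms (same budget as ★ p853378 ∕ p853410)
include hH' hw hv hH'w hH'i hH'u hreg hirr h ht in
open scoped Classical in
/-- **THE KEY STEP (the four class values at once).**  Frame `T` (★ Jacobowitz at an unramified inert place), block frame `c_fr = T·c_w` and its algebra map `φ_b` (★ (O-5)),
`J₀`-unitarity of `φ_b(g_w, u_w) = T δ_w T⁻¹` (★ `localNonsplitCongr`), the torus memberships of `(g_w, u_w)`, then ★ (B2d)'s block X fed to ★ (B2b-II) ∕ ★ (B2c-II).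
[cite: Rogawski1990, §4.9 Lemma 4.9.3 p. 56, Prop. 4.9.1 (b) p. 55; §4.8 Case (a) p. 53] [cite: Kottwitz1986BaseChangeUnits, §1 pp. 240–241] [cite: Flicker1998UnitaryFL, Props. 16–17 pp. 96–97, Theorem 18 p. 97] -/
private theorem class_values_of_eisensteinData
    -- the Eisenstein block of the (B3) head (★ F2 `exists_eisensteinData` ∕ ★ (W1)'s letters, `ϖ`-currency), the depth-zero letters `hg1 hu1`
    {ϖ : w.1.adicCompletion L} (hϖ : Valued.v ϖ = WithZero.exp (-1 : ℤ))
    {Θ : Matrix (Fin 2) (Fin 2) (w.1.adicCompletion L)} {α β a b : w.1.adicCompletion L}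
    (hΘ : Θ = α • (1 : Matrix (Fin 2) (Fin 2) (w.1.adicCompletion L)) +
      β • ((γH.1.val : GL (Fin 2) (LocalRing L v)).val.map (Pi.evalRingHom (fun w' : PlacesOver L v => w'.1.adicCompletion L) w)))
    (hΘd : Valued.v Θ.det = Valued.v ϖ) (hΘt : Valued.v Θ.trace < 1)
    (hrel : finGammaTwo L v γH w • (1 : Matrix (Fin 2) (Fin 2) (w.1.adicCompletion L)) -
        (γH.1.val : GL (Fin 2) (LocalRing L v)).val.map (Pi.evalRingHom (fun w' : PlacesOver L v => w'.1.adicCompletion L) w) =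
      a • (1 : Matrix (Fin 2) (Fin 2) (w.1.adicCompletion L)) + b • Θ)
    (n N : ℕ) (hn : Valued.v (((finCharpolyTwo L v γH).eval (finGammaTwo L v γH)) w) = WithZero.exp (-(n : ℤ)))
    (hb : Valued.v b = Valued.v ϖ ^ N)
    (hg1 : ∀ i j, Valued.v ((((γH.1.val : GL (Fin 2) (LocalRing L v)).val.map (Pi.evalRingHom (fun w' : PlacesOver L v => w'.1.adicCompletion L) w)) - 1) i j) ≤
      WithZero.exp (-1 : ℤ))
    (hu1 : Valued.v (finGammaTwo L v γH w - 1) ≤ WithZero.exp (-1 : ℤ)) :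
    (finKappaAt L v H' γH δ = 1 →
      (({q : (cmDatum L 3 H').Local v ⧸ cmLocalIntegralLevel L 3 H' v |
            q ∈ MulAction.fixedBy ((cmDatum L 3 H').Local v ⧸ cmLocalIntegralLevel L 3 H' v) δ ∧
              (redMat ((((q.out⁻¹ * δ * q.out : (cmDatum L 3 H').Local v)).val : GL (Fin 3) (LocalRing L v)).val.map
                (Pi.evalRingHom (fun w' : UnitaryGroup.PlacesOver L v => w'.1.adicCompletion L) w)) - 1).rank = 0}.ncard +
        {q : (cmDatum L 3 H').Local v ⧸ cmLocalIntegralLevel L 3 H' v |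
            q ∈ MulAction.fixedBy ((cmDatum L 3 H').Local v ⧸ cmLocalIntegralLevel L 3 H' v) δ ∧
              (redMat ((((q.out⁻¹ * δ * q.out : (cmDatum L 3 H').Local v)).val : GL (Fin 3) (LocalRing L v)).val.map
                (Pi.evalRingHom (fun w' : UnitaryGroup.PlacesOver L v => w'.1.adicCompletion L) w)) - 1).rank = 1}.ncard +
        {q : (cmDatum L 3 H').Local v ⧸ cmLocalIntegralLevel L 3 H' v |
            q ∈ MulAction.fixedBy ((cmDatum L 3 H').Local v ⧸ cmLocalIntegralLevel L 3 H' v) δ ∧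
              (redMat ((((q.out⁻¹ * δ * q.out : (cmDatum L 3 H').Local v)).val : GL (Fin 3) (LocalRing L v)).val.map
                (Pi.evalRingHom (fun w' : UnitaryGroup.PlacesOver L v => w'.1.adicCompletion L) w)) - 1).rank = 2}.ncard : ℕ) : ℚ) =
      phiTHn (Nat.card 𝓀[v.adicCompletion ↥(maximalRealSubfield L)]) n N) ∧
    (finKappaAt L v H' γH δ = -1 →
      (({q : (cmDatum L 3 H').Local v ⧸ cmLocalIntegralLevel L 3 H' v |
            q ∈ MulAction.fixedBy ((cmDatum L 3 H').Local v ⧸ cmLocalIntegralLevel L 3 H' v) δ ∧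
              (redMat ((((q.out⁻¹ * δ * q.out : (cmDatum L 3 H').Local v)).val : GL (Fin 3) (LocalRing L v)).val.map
                (Pi.evalRingHom (fun w' : UnitaryGroup.PlacesOver L v => w'.1.adicCompletion L) w)) - 1).rank = 0}.ncard +
        {q : (cmDatum L 3 H').Local v ⧸ cmLocalIntegralLevel L 3 H' v |
            q ∈ MulAction.fixedBy ((cmDatum L 3 H').Local v ⧸ cmLocalIntegralLevel L 3 H' v) δ ∧
              (redMat ((((q.out⁻¹ * δ * q.out : (cmDatum L 3 H').Local v)).val : GL (Fin 3) (LocalRing L v)).val.map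
                (Pi.evalRingHom (fun w' : UnitaryGroup.PlacesOver L v => w'.1.adicCompletion L) w)) - 1).rank = 1}.ncard +
        {q : (cmDatum L 3 H').Local v ⧸ cmLocalIntegralLevel L 3 H' v |
            q ∈ MulAction.fixedBy ((cmDatum L 3 H').Local v ⧸ cmLocalIntegralLevel L 3 H' v) δ ∧
              (redMat ((((q.out⁻¹ * δ * q.out : (cmDatum L 3 H').Local v)).val : GL (Fin 3) (LocalRing L v)).val.map
                (Pi.evalRingHom (fun w' : UnitaryGroup.PlacesOver L v => w'.1.adicCompletion L) w)) - 1).rank = 2}.ncard : ℕ) : ℚ) =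
      phiTHprimen (Nat.card 𝓀[v.adicCompletion ↥(maximalRealSubfield L)]) n N) ∧
    (2 ≤ n → 1 ≤ N → finKappaAt L v H' γH δ = 1 →
      (({q : (cmDatum L 3 H').Local v ⧸ cmLocalIntegralLevel L 3 H' v |
            q ∈ MulAction.fixedBy ((cmDatum L 3 H').Local v ⧸ cmLocalIntegralLevel L 3 H' v) δ ∧
              (redMat ((((q.out⁻¹ * δ * q.out : (cmDatum L 3 H').Local v)).val : GL (Fin 3) (LocalRing L v)).val.map
                (Pi.evalRingHom (fun w' : UnitaryGroup.PlacesOver L v => w'.1.adicCompletion L) w)) - 1).rank = 0}.ncard : ℕ) : ℚ) =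
      phiTHn (Nat.card 𝓀[v.adicCompletion ↥(maximalRealSubfield L)]) (n - 2) (N - 1)) ∧
    (2 ≤ n → 1 ≤ N → finKappaAt L v H' γH δ = -1 →
      (({q : (cmDatum L 3 H').Local v ⧸ cmLocalIntegralLevel L 3 H' v |
            q ∈ MulAction.fixedBy ((cmDatum L 3 H').Local v ⧸ cmLocalIntegralLevel L 3 H' v) δ ∧
              (redMat ((((q.out⁻¹ * δ * q.out : (cmDatum L 3 H').Local v)).val : GL (Fin 3) (LocalRing L v)).val.map
                (Pi.evalRingHom (fun w' : UnitaryGroup.PlacesOver L v => w'.1.adicCompletion L) w)) - 1).rank = 0}.ncard : ℕ) : ℚ) =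
      phiTHprimen (Nat.card 𝓀[v.adicCompletion ↥(maximalRealSubfield L)]) (n - 2) (N - 1)) := by
  classical
  have hc1 : IsCMField.complexConj L ≠ 1 := IsCMField.complexConj_ne_one L
  haveI : Algebra.IsQuadraticExtension ↥(maximalRealSubfield L) L := IsCMField.isQuadraticExtension L
  set σ : w.1.adicCompletion L →+* w.1.adicCompletion L := galAdicCompletionMap (L := L) (IsCMField.complexConj L) hw with hσdef
  set ev := Pi.evalRingHom (fun w' : PlacesOver L v => w'.1.adicCompletion L) w with hev
  -- ### (1) the block frame `c` of the match, the integral frame `T` of `H′_w`, the block frame `c_fr = T·c_w` and its algebra map `φ_b`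
  obtain ⟨cj, hcj⟩ := isConj_iff.1 h
  obtain ⟨T, hTint, hJT⟩ := exists_glInt_placeForm_eq_formCongr_antidiagonal_of_isUnramifiedIn ↥(maximalRealSubfield L) L (IsCMField.complexConj L) hc1 3 H' hH' v w hw hv
    hH'w hH'i
  set cw : GL (Fin 3) (w.1.adicCompletion L) := Units.map (RingHom.mapMatrix ev).toMonoidHom cj with hcw
  have hcwval : (cw : Matrix (Fin 3) (Fin 3) (w.1.adicCompletion L)) = ((cj : GL (Fin 3) (LocalRing L v)) : Matrix (Fin 3) (Fin 3) (LocalRing L v)).map ev := rfl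
  have hcfr : ((T * cw : GL (Fin 3) (w.1.adicCompletion L)) : Matrix (Fin 3) (Fin 3) (w.1.adicCompletion L)) = (T : Matrix (Fin 3) (Fin 3) (w.1.adicCompletion L)) *
      ((cj : GL (Fin 3) (LocalRing L v)) : Matrix (Fin 3) (Fin 3) (LocalRing L v)).map ev := by rw [Units.val_mul, hcwval]
  obtain ⟨φb, hφb⟩ := exists_algHom_blockFrame (T * cw)
  -- ### (2) the form `J₀` as a unit: integral, hermitian
  have hΦw : IsUnit (placeForm ((StdForm.antidiagonal 3).over L) w.1) := by
    rw [placeForm_antidiagonal]; exact (StdForm.antidiagonal 3).isUnit_over _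
  have hJ : hΦw.unit ∈ glInt 3 (w.1.adicCompletion L) := isUnit_placeForm_antidiagonal_unit_mem_glInt (E := L) (N := 3) w.1 hΦw
  have hJ0m : ((hΦw.unit : GL (Fin 3) (w.1.adicCompletion L)) : Matrix (Fin 3) (Fin 3) (w.1.adicCompletion L)) =
      (StdForm.antidiagonal 3).over (w.1.adicCompletion L) := by rw [IsUnit.unit_spec, placeForm_antidiagonal]
  have hJh : (((hΦw.unit : GL (Fin 3) (w.1.adicCompletion L)) : Matrix (Fin 3) (Fin 3) (w.1.adicCompletion L)).map σ)ᵀ = hΦw.unit := by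
    rw [hJ0m, StdForm.over_map, StdForm.transpose_over]
  -- ### (3) `φ_b(g_w, u_w) = T δ_w T⁻¹` (★ (O-5)-place at `c`, then conjugation by `T`)
  obtain ⟨φ₀, hφ₀, hφ₀w⟩ := exists_algHom_blockFrame_apply_eq_of_conj_place L H' w γH hcj
  have hframe : φb (((γH.1.val : GL (Fin 2) (LocalRing L v)).val.map ev), finGammaTwo L v γH w) =
      (T : Matrix (Fin 3) (Fin 3) (w.1.adicCompletion L)) *
        ((δ.val : GL (Fin 3) (LocalRing L v)) : Matrix (Fin 3) (Fin 3) (LocalRing L v)).map ev *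
        ((T⁻¹ : GL (Fin 3) (w.1.adicCompletion L)) : Matrix (Fin 3) (Fin 3) (w.1.adicCompletion L)) := by
    have e1 := hφ₀ (((γH.1.val : GL (Fin 2) (LocalRing L v)).val.map ev)) (finGammaTwo L v γH w)
    rw [hφ₀w] at e1
    rw [hφb, _root_.mul_inv_rev, Units.val_mul, Units.val_mul, e1]
    simp only [Matrix.mul_assoc]
    rfl
  -- ### (4) `T δ_w T⁻¹ ∈ U(σ_w, J₀)` (★ `localNonsplitCongr` along `T`), so `φ_b(g_w, u_w)` is `J₀`-unitary
  have hF : formCongr σ T (placeForm (Matrix.of fun i j : Fin 3 => if i.val + j.val + 1 = 3 then (1 : L) else 0) w.1) =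
      (1 : w.1.adicCompletion L) • placeForm H' w.1 := by
    rw [one_smul, placeForm_antidiagOne, ← hJT]
  set e := (localNonsplitCongr (IsCMField.complexConj L) hc1 w hw T isUnit_one hF).trans
    (localNonsplitEquiv (IsCMField.complexConj L) (Matrix.of fun i j : Fin 3 => if i.val + j.val + 1 = 3 then (1 : L) else 0) hc1 w hw) with he
  have hform : ((e δ).val : GL (Fin 3) (w.1.adicCompletion L)) =
      T * ((localNonsplitEquiv (IsCMField.complexConj L) H' hc1 w hw δ).val : GL (Fin 3) (w.1.adicCompletion L)) * T⁻¹ :=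
    (congrArg (fun x : ↥(unitaryGroupOfForm (galAdicCompletionMap (L := L) (IsCMField.complexConj L) hw)
        (placeForm (Matrix.of fun i j : Fin 3 => if i.val + j.val + 1 = 3 then (1 : L) else 0) w.1)) => (x.val : GL (Fin 3) (w.1.adicCompletion L)))
          (ContinuousMulEquiv.trans_apply _ _ δ)).trans
      (localNonsplitEquiv_localNonsplitCongr (IsCMField.complexConj L) hc1 w hw T isUnit_one hF δ)
  have hmat : (((e δ).val : GL (Fin 3) (w.1.adicCompletion L)) : Matrix (Fin 3) (Fin 3) (w.1.adicCompletion L)) =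
      (T : Matrix (Fin 3) (Fin 3) (w.1.adicCompletion L)) *
        ((δ.val : GL (Fin 3) (LocalRing L v)) : Matrix (Fin 3) (Fin 3) (LocalRing L v)).map ev *
        ((T⁻¹ : GL (Fin 3) (w.1.adicCompletion L)) : Matrix (Fin 3) (Fin 3) (w.1.adicCompletion L)) := by
    rw [hform, Units.val_mul, Units.val_mul]
    rfl
  have hτJ : ((φb (((γH.1.val : GL (Fin 2) (LocalRing L v)).val.map ev), finGammaTwo L v γH w)).map σ)ᵀ *
      ((hΦw.unit : GL (Fin 3) (w.1.adicCompletion L)) : Matrix (Fin 3) (Fin 3) (w.1.adicCompletion L)) *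
      φb (((γH.1.val : GL (Fin 2) (LocalRing L v)).val.map ev), finGammaTwo L v γH w) = hΦw.unit := by
    have hU := mem_unitaryGroupOfForm_iff.1 (e δ).2
    rw [hmat, placeForm_antidiagOne] at hU
    rw [hframe, hJ0m]
    exact hU
  -- ### (5) the torus memberships of `(g_w, u_w)` and their integrality (depth zero)
  have hσu : finGammaTwo L v γH w * σ (finGammaTwo L v γH w) = 1 := by
    rw [mul_comm]; exact map_finGammaTwo_mul_finGammaTwo L v w hw γH
  have hgunit : (((γH.1.val : GL (Fin 2) (LocalRing L v)).val.map ev).map σ)ᵀ * (!![0, 1; 1, 0] : Matrix (Fin 2) (Fin 2) (w.1.adicCompletion L)) *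
      ((γH.1.val : GL (Fin 2) (LocalRing L v)).val.map ev) = !![0, 1; 1, 0] := by
    have hU2 := transpose_map_fst_evalRingHom_mul L v w hw γH
    rw [UnitaryGroup.placeForm_antidiagTwo_eq] at hU2
    exact hU2
  have hO1 : ∀ x : w.1.adicCompletion L, Valued.v (x - 1) ≤ WithZero.exp (-1 : ℤ) → x ∈ 𝒪[w.1.adicCompletion L] := fun x hx => by
    have hx1 : x - 1 ∈ 𝒪[w.1.adicCompletion L] := (v_le_one_iff_mem_integer _).1 (hx.trans (WithZero.exp_le_exp.2 (by norm_num) |>.trans_eq WithZero.exp_zero))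
    simpa only [sub_add_cancel] using add_mem hx1 (one_mem 𝒪[w.1.adicCompletion L])
  have hg : ∀ i j, ((γH.1.val : GL (Fin 2) (LocalRing L v)).val.map ev) i j ∈ 𝒪[w.1.adicCompletion L] := fun i j => by
    by_cases hij : i = j
    · subst hij; exact hO1 _ (by simpa only [Matrix.sub_apply, Matrix.one_apply_eq] using hg1 i i)
    · have h1 := hg1 i j
      rw [Matrix.sub_apply, Matrix.one_apply_ne hij, sub_zero] at h1
      exact (v_le_one_iff_mem_integer _).1 (h1.trans (WithZero.exp_le_exp.2 (by norm_num) |>.trans_eq WithZero.exp_zero))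
  have hu : finGammaTwo L v γH w ∈ 𝒪[w.1.adicCompletion L] := hO1 _ hu1
  -- ### (6) ★ (B2d): ★ F5-(0)'s block X for `(J₀, c_fr, φ_b)` from the Eisenstein letters (row split inside)
  obtain ⟨M, _, _, _, w₁, aF, k₀, θ, s', φ, lam, P, ⟨haF, hk₀, hθ, hθv, hcoord, hint, hs'ι, hs'θ, hs's', hs'O, hs'v, hnorm1⟩, ⟨hφ, hstar⟩,
      ⟨hlam, hφx, hK, hall, hcoordlam⟩, ⟨hP, hPx⟩, hgateV⟩ :=
    exists_pairPackage_inertPlace L w hw hv hΦw.unit hJ hJh (T * cw) φb hφb hg hu hσu hτJ hgunit hϖ hΘ hΘd hΘt hrel hb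
  rw [hJ0m] at hstar hgateV
  -- ### (7) ★ (B2b-II) ∕ ★ (B2c-II) at this frame
  refine ⟨fun hκ => ?_, fun hκ => ?_, fun hn2 hN1 hκ => ?_, fun hn2 hN1 hκ => ?_⟩
  · exact sum_ncard_rankStrata_eq_phiTHn_of_frame_of_finKappaAt_eq_one hH' w hw hv hH'u hreg hirr δ h ht hcj T hTint hJT w₁ haF hk₀ s' hθ hθv hcoord hint hs'ι hs'θ hs's'
      hs'O hs'v hnorm1 (T * cw) hcfr φb hφb φ hφ hstar hϖ hΘ hΘd hΘt hrel n N hn hb hg1 hu1 hlam hφx hK hall hcoordlam P hP hPx hgateV hκ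
  · exact sum_ncard_rankStrata_eq_phiTHprimen_of_frame_of_finKappaAt_eq_neg_one hH' w hw hv hH'u hreg hirr δ h ht hcj T hTint hJT w₁ haF hk₀ s' hθ hθv hcoord hint hs'ι hs'θ
      hs's' hs'O hs'v hnorm1 (T * cw) hcfr φb hφb φ hφ hstar hϖ hΘ hΘd hΘt hrel n N hn hb hg1 hu1 hlam hφx hK hall hcoordlam P hP hPx hgateV hκ
  · exact ncard_rankStrata_zero_eq_phiTHn_of_frame_of_finKappaAt_eq_one hH' w hw hv hH'u hirr δ h ht hcj T hTint hJT w₁ haF hk₀ s' hθ hθv hcoord hint hs'ι hs'θ hs's' hs'O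
      hs'v hnorm1 (T * cw) hcfr φb hφb φ hφ hstar hϖ hΘ hΘd hΘt hrel n N hn hb hg1 hu1 hlam hφx hall hcoordlam P hP hPx hgateV hn2 hN1 hκ
  · exact ncard_rankStrata_zero_eq_phiTHprimen_of_frame_of_finKappaAt_eq_neg_one hH' w hw hv hH'u hirr δ h ht hcj T hTint hJT w₁ haF hk₀ s' hθ hθv hcoord hint hs'ι hs'θ hs's'
      hs'O hs'v hnorm1 (T * cw) hcfr φb hφb φ hφ hstar hϖ hΘ hΘd hΘt hrel n N hn hb hg1 hu1 hlam hφx hall hcoordlam P hP hPx hgateV hn2 hN1 hκ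

include hH' hw hv hH'w hH'i hH'u hreg hirr h ht in
open scoped Classical in
/-- **(B2e), TOTALS, CLASS I: `n₀(δ) + n₁(δ) + n₂(δ) = Φ_n(N) = phiTHn q n N`** for a deep type-(2) match `δ` with `κ_v(γ_H, δ) = +1` at an inert place unramified in `L`
(any residue characteristic), over the (B3) head's own letters (Eisenstein block, `hg1 hu1`); `q = #𝓀(L⁺_v)`.  Docks the (B3) placeholder `hTp`.
[cite: Rogawski1990, §4.9 Lemma 4.9.3 p. 56, Prop. 4.9.1 (b) p. 55] [cite: Kottwitz1986BaseChangeUnits, §1 pp. 240–241] [cite: Flicker1998UnitaryFL, Prop. 11 p. 87; Theorem 18 p. 97] -/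
theorem sum_ncard_rankStrata_eq_phiTHn_of_eisensteinData_of_finKappaAt_eq_one
    -- the Eisenstein block of the (B3) head (★ F2 `exists_eisensteinData` ∕ ★ (W1)'s letters, `ϖ`-currency), the depth-zero letters `hg1 hu1`
    {ϖ : w.1.adicCompletion L} (hϖ : Valued.v ϖ = WithZero.exp (-1 : ℤ))
    {Θ : Matrix (Fin 2) (Fin 2) (w.1.adicCompletion L)} {α β a b : w.1.adicCompletion L}
    (hΘ : Θ = α • (1 : Matrix (Fin 2) (Fin 2) (w.1.adicCompletion L)) +
      β • ((γH.1.val : GL (Fin 2) (LocalRing L v)).val.map (Pi.evalRingHom (fun w' : PlacesOver L v => w'.1.adicCompletion L) w)))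
    (hΘd : Valued.v Θ.det = Valued.v ϖ) (hΘt : Valued.v Θ.trace < 1)
    (hrel : finGammaTwo L v γH w • (1 : Matrix (Fin 2) (Fin 2) (w.1.adicCompletion L)) -
        (γH.1.val : GL (Fin 2) (LocalRing L v)).val.map (Pi.evalRingHom (fun w' : PlacesOver L v => w'.1.adicCompletion L) w) =
      a • (1 : Matrix (Fin 2) (Fin 2) (w.1.adicCompletion L)) + b • Θ)
    (n N : ℕ) (hn : Valued.v (((finCharpolyTwo L v γH).eval (finGammaTwo L v γH)) w) = WithZero.exp (-(n : ℤ)))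
    (hb : Valued.v b = Valued.v ϖ ^ N)
    (hg1 : ∀ i j, Valued.v ((((γH.1.val : GL (Fin 2) (LocalRing L v)).val.map (Pi.evalRingHom (fun w' : PlacesOver L v => w'.1.adicCompletion L) w)) - 1) i j) ≤
      WithZero.exp (-1 : ℤ))
    (hu1 : Valued.v (finGammaTwo L v γH w - 1) ≤ WithZero.exp (-1 : ℤ))
    (hκ : finKappaAt L v H' γH δ = 1) :
    (({q : (cmDatum L 3 H').Local v ⧸ cmLocalIntegralLevel L 3 H' v |
            q ∈ MulAction.fixedBy ((cmDatum L 3 H').Local v ⧸ cmLocalIntegralLevel L 3 H' v) δ ∧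
              (redMat ((((q.out⁻¹ * δ * q.out : (cmDatum L 3 H').Local v)).val : GL (Fin 3) (LocalRing L v)).val.map
                (Pi.evalRingHom (fun w' : UnitaryGroup.PlacesOver L v => w'.1.adicCompletion L) w)) - 1).rank = 0}.ncard +
        {q : (cmDatum L 3 H').Local v ⧸ cmLocalIntegralLevel L 3 H' v |
            q ∈ MulAction.fixedBy ((cmDatum L 3 H').Local v ⧸ cmLocalIntegralLevel L 3 H' v) δ ∧
              (redMat ((((q.out⁻¹ * δ * q.out : (cmDatum L 3 H').Local v)).val : GL (Fin 3) (LocalRing L v)).val.map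
                (Pi.evalRingHom (fun w' : UnitaryGroup.PlacesOver L v => w'.1.adicCompletion L) w)) - 1).rank = 1}.ncard +
        {q : (cmDatum L 3 H').Local v ⧸ cmLocalIntegralLevel L 3 H' v |
            q ∈ MulAction.fixedBy ((cmDatum L 3 H').Local v ⧸ cmLocalIntegralLevel L 3 H' v) δ ∧
              (redMat ((((q.out⁻¹ * δ * q.out : (cmDatum L 3 H').Local v)).val : GL (Fin 3) (LocalRing L v)).val.map
                (Pi.evalRingHom (fun w' : UnitaryGroup.PlacesOver L v => w'.1.adicCompletion L) w)) - 1).rank = 2}.ncard : ℕ) : ℚ) =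
      phiTHn (Nat.card 𝓀[v.adicCompletion ↥(maximalRealSubfield L)]) n N :=
  (class_values_of_eisensteinData hH' w hw hv hH'w hH'i hH'u hreg hirr δ h ht hϖ hΘ hΘd hΘt hrel n N hn hb hg1 hu1).1 hκ

include hH' hw hv hH'w hH'i hH'u hreg hirr h ht in
open scoped Classical in
/-- **(B2e), TOTALS, CLASS II: `n₀(δ) + n₁(δ) + n₂(δ) = Φ′_n(N) = phiTHprimen q n N`** for a deep type-(2) match `δ` with `κ_v(γ_H, δ) = −1` (same letters).  Docks `hTm`.
[cite: Rogawski1990, §4.9 Lemma 4.9.3 p. 56, Prop. 4.9.1 (b) p. 55] [cite: Kottwitz1986BaseChangeUnits, §1 pp. 240–241] [cite: Flicker1998UnitaryFL, Props. 16–17 pp. 96–97; Theorem 18 p. 97] -/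
theorem sum_ncard_rankStrata_eq_phiTHprimen_of_eisensteinData_of_finKappaAt_eq_neg_one
    -- the Eisenstein block of the (B3) head (★ F2 `exists_eisensteinData` ∕ ★ (W1)'s letters, `ϖ`-currency), the depth-zero letters `hg1 hu1`
    {ϖ : w.1.adicCompletion L} (hϖ : Valued.v ϖ = WithZero.exp (-1 : ℤ))
    {Θ : Matrix (Fin 2) (Fin 2) (w.1.adicCompletion L)} {α β a b : w.1.adicCompletion L}
    (hΘ : Θ = α • (1 : Matrix (Fin 2) (Fin 2) (w.1.adicCompletion L)) +
      β • ((γH.1.val : GL (Fin 2) (LocalRing L v)).val.map (Pi.evalRingHom (fun w' : PlacesOver L v => w'.1.adicCompletion L) w)))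
    (hΘd : Valued.v Θ.det = Valued.v ϖ) (hΘt : Valued.v Θ.trace < 1)
    (hrel : finGammaTwo L v γH w • (1 : Matrix (Fin 2) (Fin 2) (w.1.adicCompletion L)) -
        (γH.1.val : GL (Fin 2) (LocalRing L v)).val.map (Pi.evalRingHom (fun w' : PlacesOver L v => w'.1.adicCompletion L) w) =
      a • (1 : Matrix (Fin 2) (Fin 2) (w.1.adicCompletion L)) + b • Θ)
    (n N : ℕ) (hn : Valued.v (((finCharpolyTwo L v γH).eval (finGammaTwo L v γH)) w) = WithZero.exp (-(n : ℤ)))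
    (hb : Valued.v b = Valued.v ϖ ^ N)
    (hg1 : ∀ i j, Valued.v ((((γH.1.val : GL (Fin 2) (LocalRing L v)).val.map (Pi.evalRingHom (fun w' : PlacesOver L v => w'.1.adicCompletion L) w)) - 1) i j) ≤
      WithZero.exp (-1 : ℤ))
    (hu1 : Valued.v (finGammaTwo L v γH w - 1) ≤ WithZero.exp (-1 : ℤ))
    (hκ : finKappaAt L v H' γH δ = -1) :
    (({q : (cmDatum L 3 H').Local v ⧸ cmLocalIntegralLevel L 3 H' v |
            q ∈ MulAction.fixedBy ((cmDatum L 3 H').Local v ⧸ cmLocalIntegralLevel L 3 H' v) δ ∧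
              (redMat ((((q.out⁻¹ * δ * q.out : (cmDatum L 3 H').Local v)).val : GL (Fin 3) (LocalRing L v)).val.map
                (Pi.evalRingHom (fun w' : UnitaryGroup.PlacesOver L v => w'.1.adicCompletion L) w)) - 1).rank = 0}.ncard +
        {q : (cmDatum L 3 H').Local v ⧸ cmLocalIntegralLevel L 3 H' v |
            q ∈ MulAction.fixedBy ((cmDatum L 3 H').Local v ⧸ cmLocalIntegralLevel L 3 H' v) δ ∧
              (redMat ((((q.out⁻¹ * δ * q.out : (cmDatum L 3 H').Local v)).val : GL (Fin 3) (LocalRing L v)).val.map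
                (Pi.evalRingHom (fun w' : UnitaryGroup.PlacesOver L v => w'.1.adicCompletion L) w)) - 1).rank = 1}.ncard +
        {q : (cmDatum L 3 H').Local v ⧸ cmLocalIntegralLevel L 3 H' v |
            q ∈ MulAction.fixedBy ((cmDatum L 3 H').Local v ⧸ cmLocalIntegralLevel L 3 H' v) δ ∧
              (redMat ((((q.out⁻¹ * δ * q.out : (cmDatum L 3 H').Local v)).val : GL (Fin 3) (LocalRing L v)).val.map
                (Pi.evalRingHom (fun w' : UnitaryGroup.PlacesOver L v => w'.1.adicCompletion L) w)) - 1).rank = 2}.ncard : ℕ) : ℚ) =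
      phiTHprimen (Nat.card 𝓀[v.adicCompletion ↥(maximalRealSubfield L)]) n N :=
  (class_values_of_eisensteinData hH' w hw hv hH'w hH'i hH'u hreg hirr δ h ht hϖ hΘ hΘd hΘt hrel n N hn hb hg1 hu1).2.1 hκ

include hH' hw hv hH'w hH'i hH'u hreg hirr h ht in
open scoped Classical in
/-- **(B2e), ROW 0, CLASS I: `n₀(δ) = Φ_{n−2}(N−1) = phiTHn q (n−2) (N−1)`** (`n ≥ 2`, `N ≥ 1`) for a deep type-(2) match `δ` with `κ_v(γ_H, δ) = +1` (same letters).  Docks `h0p`.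
[cite: Rogawski1990, §4.9 Lemma 4.9.3 p. 56, Prop. 4.9.1 (b) p. 55] [cite: Kottwitz1986BaseChangeUnits, §1 pp. 240–241] [cite: Flicker1998UnitaryFL, Prop. 11 p. 87; Theorem 18 p. 97] -/
theorem ncard_rankStrata_zero_eq_phiTHn_of_eisensteinData_of_finKappaAt_eq_one
    -- the Eisenstein block of the (B3) head (★ F2 `exists_eisensteinData` ∕ ★ (W1)'s letters, `ϖ`-currency), the depth-zero letters `hg1 hu1`
    {ϖ : w.1.adicCompletion L} (hϖ : Valued.v ϖ = WithZero.exp (-1 : ℤ))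
    {Θ : Matrix (Fin 2) (Fin 2) (w.1.adicCompletion L)} {α β a b : w.1.adicCompletion L}
    (hΘ : Θ = α • (1 : Matrix (Fin 2) (Fin 2) (w.1.adicCompletion L)) +
      β • ((γH.1.val : GL (Fin 2) (LocalRing L v)).val.map (Pi.evalRingHom (fun w' : PlacesOver L v => w'.1.adicCompletion L) w)))
    (hΘd : Valued.v Θ.det = Valued.v ϖ) (hΘt : Valued.v Θ.trace < 1)
    (hrel : finGammaTwo L v γH w • (1 : Matrix (Fin 2) (Fin 2) (w.1.adicCompletion L)) -
        (γH.1.val : GL (Fin 2) (LocalRing L v)).val.map (Pi.evalRingHom (fun w' : PlacesOver L v => w'.1.adicCompletion L) w) =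
      a • (1 : Matrix (Fin 2) (Fin 2) (w.1.adicCompletion L)) + b • Θ)
    (n N : ℕ) (hn : Valued.v (((finCharpolyTwo L v γH).eval (finGammaTwo L v γH)) w) = WithZero.exp (-(n : ℤ)))
    (hb : Valued.v b = Valued.v ϖ ^ N)
    (hg1 : ∀ i j, Valued.v ((((γH.1.val : GL (Fin 2) (LocalRing L v)).val.map (Pi.evalRingHom (fun w' : PlacesOver L v => w'.1.adicCompletion L) w)) - 1) i j) ≤
      WithZero.exp (-1 : ℤ))
    (hu1 : Valued.v (finGammaTwo L v γH w - 1) ≤ WithZero.exp (-1 : ℤ))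
    (hn2 : 2 ≤ n) (hN1 : 1 ≤ N) (hκ : finKappaAt L v H' γH δ = 1) :
    (({q : (cmDatum L 3 H').Local v ⧸ cmLocalIntegralLevel L 3 H' v |
            q ∈ MulAction.fixedBy ((cmDatum L 3 H').Local v ⧸ cmLocalIntegralLevel L 3 H' v) δ ∧
              (redMat ((((q.out⁻¹ * δ * q.out : (cmDatum L 3 H').Local v)).val : GL (Fin 3) (LocalRing L v)).val.map
                (Pi.evalRingHom (fun w' : UnitaryGroup.PlacesOver L v => w'.1.adicCompletion L) w)) - 1).rank = 0}.ncard : ℕ) : ℚ) =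
      phiTHn (Nat.card 𝓀[v.adicCompletion ↥(maximalRealSubfield L)]) (n - 2) (N - 1) :=
  (class_values_of_eisensteinData hH' w hw hv hH'w hH'i hH'u hreg hirr δ h ht hϖ hΘ hΘd hΘt hrel n N hn hb hg1 hu1).2.2.1 hn2 hN1 hκ

include hH' hw hv hH'w hH'i hH'u hreg hirr h ht in
open scoped Classical in
/-- **(B2e), ROW 0, CLASS II: `n₀(δ) = Φ′_{n−2}(N−1) = phiTHprimen q (n−2) (N−1)`** (`n ≥ 2`, `N ≥ 1`) for a deep type-(2) match `δ` with `κ_v(γ_H, δ) = −1` (same letters).  Docks `h0m`.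
[cite: Rogawski1990, §4.9 Lemma 4.9.3 p. 56, Prop. 4.9.1 (b) p. 55] [cite: Kottwitz1986BaseChangeUnits, §1 pp. 240–241] [cite: Flicker1998UnitaryFL, Props. 16–17 pp. 96–97; Theorem 18 p. 97] -/
theorem ncard_rankStrata_zero_eq_phiTHprimen_of_eisensteinData_of_finKappaAt_eq_neg_one
    -- the Eisenstein block of the (B3) head (★ F2 `exists_eisensteinData` ∕ ★ (W1)'s letters, `ϖ`-currency), the depth-zero letters `hg1 hu1`
    {ϖ : w.1.adicCompletion L} (hϖ : Valued.v ϖ = WithZero.exp (-1 : ℤ))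
    {Θ : Matrix (Fin 2) (Fin 2) (w.1.adicCompletion L)} {α β a b : w.1.adicCompletion L}
    (hΘ : Θ = α • (1 : Matrix (Fin 2) (Fin 2) (w.1.adicCompletion L)) +
      β • ((γH.1.val : GL (Fin 2) (LocalRing L v)).val.map (Pi.evalRingHom (fun w' : PlacesOver L v => w'.1.adicCompletion L) w)))
    (hΘd : Valued.v Θ.det = Valued.v ϖ) (hΘt : Valued.v Θ.trace < 1)
    (hrel : finGammaTwo L v γH w • (1 : Matrix (Fin 2) (Fin 2) (w.1.adicCompletion L)) -
        (γH.1.val : GL (Fin 2) (LocalRing L v)).val.map (Pi.evalRingHom (fun w' : PlacesOver L v => w'.1.adicCompletion L) w) =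
      a • (1 : Matrix (Fin 2) (Fin 2) (w.1.adicCompletion L)) + b • Θ)
    (n N : ℕ) (hn : Valued.v (((finCharpolyTwo L v γH).eval (finGammaTwo L v γH)) w) = WithZero.exp (-(n : ℤ)))
    (hb : Valued.v b = Valued.v ϖ ^ N)
    (hg1 : ∀ i j, Valued.v ((((γH.1.val : GL (Fin 2) (LocalRing L v)).val.map (Pi.evalRingHom (fun w' : PlacesOver L v => w'.1.adicCompletion L) w)) - 1) i j) ≤
      WithZero.exp (-1 : ℤ))
    (hu1 : Valued.v (finGammaTwo L v γH w - 1) ≤ WithZero.exp (-1 : ℤ))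
    (hn2 : 2 ≤ n) (hN1 : 1 ≤ N) (hκ : finKappaAt L v H' γH δ = -1) :
    (({q : (cmDatum L 3 H').Local v ⧸ cmLocalIntegralLevel L 3 H' v |
            q ∈ MulAction.fixedBy ((cmDatum L 3 H').Local v ⧸ cmLocalIntegralLevel L 3 H' v) δ ∧
              (redMat ((((q.out⁻¹ * δ * q.out : (cmDatum L 3 H').Local v)).val : GL (Fin 3) (LocalRing L v)).val.map
                (Pi.evalRingHom (fun w' : UnitaryGroup.PlacesOver L v => w'.1.adicCompletion L) w)) - 1).rank = 0}.ncard : ℕ) : ℚ) =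
      phiTHprimen (Nat.card 𝓀[v.adicCompletion ↥(maximalRealSubfield L)]) (n - 2) (N - 1) :=
  (class_values_of_eisensteinData hH' w hw hv hH'w hH'i hH'u hreg hirr δ h ht hϖ hΘ hΘd hΘt hrel n N hn hb hg1 hu1).2.2.2 hn2 hN1 hκ

end Eisenstein

end Literature.NumberTheory.Rogawski1990

end
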